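import Mathlib
import Summits.Ventures.PercRepro2.SepSplitTensor

/-!
# Gluing at a general separator, XVIII: the `n`-LEVEL CONTRACTION as one statement — the typed
count contracts along any tree of terminal splits (blind cell PercRepro2, mine-2 g50, 2026-08-29;
`conjectures/MINE-2.md` M2-105; g49's successor item (iv))

The tensor form `typedCount_eq_tensorT` of `SepSplitTensor` sorts both sides of a terminal split
by their exact data and contracts the kernel between them; each side count is again a typed count
of a terminal kernel of the side (`farCount_sideF_eq_typedCount_connData`), so the identity
iterates — `typedCount_eq_tensorT_two` is the two-level instance.  Here the iteration is ONE
statement: a **split tree** `SplitTree V ζ` (`leaf`, or `node ι σ side VL VH L H`: a separator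
`σ : ι → V`, a side assignment of the current terminals `ζ`, the two sides, and a split tree of
each side over the terminals `ζ ⊕ ι` — the old terminals and the separator vertices); the
**contraction** `contract ends Z T KZ F z τ` of a kernel `KZ` along `T` is the typed count at a
leaf and, at a node, `Σ_{pL} Σ_{pH} contract(L, exactKT pL) · contract(H, exactKT pH) ·
KZ(glued(pH, pL))` with the typed edges and the pinning restricted to the sides; the tree is
**valid** (`Valid`) when every node is a terminal split (`SepSplitT`) of its side.  THE THEOREM
`typedCount_eq_contract`: for every valid tree, `typedCount F z τ (KZ ∘ connData) = contract`.
Row 2′TRI's typed count is the case `ζ = Fin 5`, `KZ = KZ3` (`typedCount_K3_eq_contract`): the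
marks' count contracts along any tree decomposition of the support, the whole weight carried by
the side counts (typed counts of exact-data indicators, nonnegative) and the kernel tensors.  Own
work; standard axioms.
-/

namespace Summit.Ventures.PercRepro2

open UnionCluster

namespace CovForm

namespace RootBridge

open OneTyped TypedA3 Untouched TypedFactor Separated

universe u v

/-! ## Split trees -/

section Tree

variable (V : Type v)

/-- **A split tree** over the terminals `ζ`: a leaf, or a node splitting the current support at a
separator `σ : ι → V` with the side assignment `side` of the terminals and the sides `VL, VH`,
followed by a split tree of each side over the terminals `ζ ⊕ ι` (the old terminals and the
separator vertices). -/
inductive SplitTree : Type u → Type (max (u + 1) v)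
  | leaf {ζ : Type u} : SplitTree ζ
  | node {ζ : Type u} (ι : Type u) [Fintype ι] [DecidableEq ι] (σ : ι → V) (side : ζ → Bool)
      (VL VH : Set V) (L : SplitTree (ζ ⊕ ι)) (H : SplitTree (ζ ⊕ ι)) : SplitTree ζ

end Tree

/-! ## The contraction and the validity of a tree -/

section Contract

open Classical

variable {V : Type v} {E : Type*} [Fintype E] [DecidableEq E] {R : Type*} [Field R]
variable (ends : E → Sym2 V)

/-- **The contraction of a kernel along a split tree**: the typed count at a leaf; at a node, the
tensor form — the two side contractions of the exact-data kernels, contracted with the kernel on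
the glued connectivities. -/
noncomputable def contract : {ζ : Type u} → [Fintype ζ] → [DecidableEq ζ] → (Z : ζ → V) →
    SplitTree V ζ → ((ζ → ζ → Bool) → (ζ → ζ → Bool) → (ζ → ζ → Bool) → ℤ) →
    Finset E → Config E → (E → ℕ) → R
  | _, _, _, Z, SplitTree.leaf, KZ, F, z, τ =>
      typedCount F z τ (fun x y w =>
        ((KZ (connData ends Z x) (connData ends Z y) (connData ends Z w) : ℤ) : R))
  | _, _, _, Z, SplitTree.node ι σ side VL VH L H, KZ, F, z, τ =>
      ∑ pL : Pat3T ι _, ∑ pH : Pat3T ι _,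
        contract (Sum.elim Z σ) L (exactKT pL) (sideF ends VL F) (withinRestr ends VL z) τ *
          contract (Sum.elim Z σ) H (exactKT pH) (sideF ends VH F) (withinRestr ends VH z) τ *
          ((gluedKT KZ side pH pL : ℤ) : R)

/-- **A valid split tree**: every node is a terminal split of its side (the typed edges within
the side, the pinning restricted to it). -/
def Valid : {ζ : Type u} → (Z : ζ → V) → SplitTree V ζ → Finset E → Config E → Prop
  | _, _, SplitTree.leaf, _, _ => True
  | _, Z, SplitTree.node _ σ side VL VH L H, F, z =>
      SepSplitT ends Z σ side VL VH F z ∧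
        Valid (Sum.elim Z σ) L (sideF ends VL F) (withinRestr ends VL z) ∧
        Valid (Sum.elim Z σ) H (sideF ends VH F) (withinRestr ends VH z)

omit [Fintype E] in
/-- A leaf is valid. -/
lemma valid_leaf {ζ : Type u} (Z : ζ → V) (F : Finset E) (z : Config E) :
    Valid ends Z (SplitTree.leaf : SplitTree V ζ) F z := trivial

/-- The contraction at a leaf is the typed count. -/
lemma contract_leaf {ζ : Type u} [Fintype ζ] [DecidableEq ζ] (Z : ζ → V)
    (KZ : (ζ → ζ → Bool) → (ζ → ζ → Bool) → (ζ → ζ → Bool) → ℤ) (F : Finset E) (z : Config E)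
    (τ : E → ℕ) :
    contract ends Z (SplitTree.leaf : SplitTree V ζ) KZ F z τ =
      typedCount F z τ (fun x y w =>
        ((KZ (connData ends Z x) (connData ends Z y) (connData ends Z w) : ℤ) : R)) := rfl

end Contract

/-! ## The theorem -/

section Main

open Classical

variable {V : Type v} {E : Type*} [Fintype E] [DecidableEq E] {R : Type*} [Field R]
variable (ends : E → Sym2 V)

/-- **THE `n`-LEVEL CONTRACTION**: for every valid split tree, the typed count of a terminal kernel
is its contraction along the tree (structural recursion on the tree: the tensor form at the root
node, the side counts rewritten as typed counts of the exact-data kernels of the sides, the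
recursion on the two subtrees). -/
theorem typedCount_eq_contract : ∀ {ζ : Type u} [Fintype ζ] [DecidableEq ζ] (Z : ζ → V)
    (T : SplitTree V ζ) (KZ : (ζ → ζ → Bool) → (ζ → ζ → Bool) → (ζ → ζ → Bool) → ℤ)
    (F : Finset E) (z : Config E) (τ : E → ℕ), Valid ends Z T F z →
    typedCount F z τ (fun x y w =>
        ((KZ (connData ends Z x) (connData ends Z y) (connData ends Z w) : ℤ) : R)) =
      contract ends Z T KZ F z τ
  | _, _, _, _, SplitTree.leaf, _, _, _, _, _ => rfl
  | _, _, _, Z, SplitTree.node ι σ side VL VH L H, KZ, F, z, τ, hT => by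
    obtain ⟨h, hL, hH⟩ : SepSplitT ends Z σ side VL VH F z ∧
        Valid ends (Sum.elim Z σ) L (sideF ends VL F) (withinRestr ends VL z) ∧
        Valid ends (Sum.elim Z σ) H (sideF ends VH F) (withinRestr ends VH z) := hT
    rw [typedCount_eq_tensorT ends Z σ KZ F z τ h]
    show _ = ∑ pL : Pat3T ι _, ∑ pH : Pat3T ι _, _
    refine Finset.sum_congr rfl fun pL _ => Finset.sum_congr rfl fun pH _ => ?_
    rw [farCount_sideF_eq_typedCount_connData ends Z σ VL F z τ pL,
      farCount_sideF_eq_typedCount_connData ends Z σ VH F z τ pH,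
      typedCount_eq_contract (Sum.elim Z σ) L (exactKT pL) _ _ τ hL,
      typedCount_eq_contract (Sum.elim Z σ) H (exactKT pH) _ _ τ hH]

end Main

/-! ## The marks -/

section Marks

open Classical

variable {V : Type v} {E : Type*} [Fintype E] [DecidableEq E] {R : Type*} [Field R]
variable (ends : E → Sym2 V) (mk : Fin 5 → V)

/-- **Row 2′TRI's typed count contracts along any valid split tree of the marks.** -/
theorem typedCount_K3_eq_contract (T : SplitTree V (Fin 5)) (F : Finset E) (z : Config E)
    (τ : E → ℕ) (hT : Valid ends mk T F z) :
    typedCount F z τ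
        (K3 ends (mk 0) (mk 1) (mk 2) (mk 3) (mk 4) : Config E → Config E → Config E → R) =
      contract ends mk T KZ3 F z τ := by
  rw [← typedCount_eq_contract ends mk T KZ3 F z τ hT]
  exact typedCount_congr' _ _ _ _ _ fun x y w => K3_eq_KZ_connData ends mk x y w

end Marks

end RootBridge

end CovForm

end Summit.Ventures.PercRepro2
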